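import Literature.Barriers.CriticalPhenomena.RigorousRGSmallParameterGaussianFactorisation
import HarnessLib

/-!
# `RigorousRGSmallParameter` (Slade, Theorem 1.4.1): the fluctuation algebra — `θF(φ,ζ) = F(φ+ζ)`,
# fluctuation-free elements `ιF(φ,ζ) = F(φ)`, the expectation `(EG)(φ) = ∫ G(φ,ζ) dP(ζ)`, its
# `𝒩`-linearity and its factorisation over regions with vanishing cross-covariance

Companion ("proof architecture") file of
`Literature/Barriers/CriticalPhenomena/RigorousRGSmallParameter.lean`. The algebraic identities of
the renormalisation group step (Maps 1–6 of [BS-rg-step] §3.1; `…Reblocking`, `…KChangeOfVariables`,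
`…RGStepAlgebra`) are stated over abstract ring maps `θ, ι : 𝒩 → 𝒩̃` into an algebra with
fluctuation fields and a map `E : 𝒩̃ → 𝒩` which is `𝒩`-linear on admissible combinations and
factorises on separated products. This file provides the concrete model on field space
`Φ = (ℝⁿ)^Λ`: "we define the map `θ : 𝒩(Λ) → 𝒩(Λ ⊔ Λ')` by making the replacement in an element of
`𝒩` of `φ` by `φ + ξ` … In applying `𝔼_{j+1}θ`, the fields `ξ` are integrated out by `𝔼_{j+1}`,
with `φ` kept fixed" ([BS-rg-step] §1.3); Slade §4.1: "`θ` is the shift operator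
`θF(φ,ζ) = F(φ+ζ)`, and `(E_CθF)(φ) = E_C F(φ+ζ)`, where the expectation `E_C` acts on `ζ` and
leaves `φ` fixed"; and [BS-rg-step] §5.1 (Map 3): "There is no `θ` operating on `Ĩ_pt`, and this
factor contains no fluctuation fields upon which `𝔼₊` can act".

## What this file provides (all proved)

* `thetaHom` (`θ`, a ring homomorphism `(Φ → ℝ) →+* (Φ → Φ → ℝ)`), `iotaHom` (`ι`), `expectOp`
  (`E`), `expectOp_thetaHom` (`E ∘ θ = E_Pθ = thetaConv`), `expectOp_one`, `expectOp_iotaHom`;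
* `SecIntegrable` and **`expectOp_sum_iotaHom_mul`**: `E(Σ_i ι(a_i) n_i) = Σ_i a_i E(n_i)` — the
  `𝒩`-linearity hypothesis `hE` of `expect_theta_circ_eq_circ_kthree`;
* `FlucDep D G` ("`G` depends on `ζ` only in `D`", jointly measurable) with its algebra
  (`mono/mul/sub/prod/sum`), `flucDep_iotaHom`, **`flucDep_thetaHom`** (`F ∈ 𝒩(D)` ⇒ `θF`
  depends on `ζ` only in `D`), `measurable_expectOp`;
* **`expectOp_mul_of_flucDep`**: `E(G₁G₂) = E(G₁)E(G₂)` under `P_C` when `Gₖ` depends on `ζ`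
  only in `Dₖ` and `C = 0` on `D₁ × D₂` (from `…GaussianFactorisation`) — the analytic half of the
  factorisation hypothesis `hEfac` of `kthree_eq_prod_components` (the geometric half is
  `…TorusGeometry.apply_eq_zero_of_subset_sclosure`).

## References

* [BrydgesSlade2015RGI] D. C. Brydges, G. Slade, *A renormalisation group method. I. Gaussian
  integration and normed algebras*, J. Stat. Phys. **159** (2015) 421–460, arXiv:1403.7244 — §2.11.
* [BrydgesSlade2015RGV] D. C. Brydges, G. Slade, *A renormalisation group method. V. A single
  renormalisation group step*, J. Stat. Phys. **159** (2015) 589–667, arXiv:1403.7256 — §1.3, §5.1.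
* [Slade2017] G. Slade, *Critical exponents for long-range O(n) models below the upper critical
  dimension*, Commun. Math. Phys. **358** (2018) 343–436, arXiv:1611.06169 — §4.1.
-/

noncomputable section

namespace Literature.Barriers.CriticalPhenomena

open _root_.MeasureTheory _root_.ProbabilityTheory Finset
open scoped ENNReal

namespace LongRangePhi4

section FluctuationAlgebra

variable {Φ : Type*} [AddCommGroup Φ]

/-- **The shift `θ`** as a ring homomorphism from functions of the field to functions of the
field and the fluctuation field: `θF(φ, ζ) = F(φ + ζ)` ("we define the map `θ : 𝒩(Λ) → 𝒩(Λ ⊔ Λ')`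
by making the replacement in an element of `𝒩` of `φ` by `φ + ξ`"). [cite: BrydgesSlade2015RGV, §1.3 (definition of θ)] [cite: Slade2017, §4.1 ("θ is the shift operator θF(φ,ζ) = F(φ+ζ)")] -/
def thetaHom (Φ : Type*) [AddCommGroup Φ] : (Φ → ℝ) →+* (Φ → Φ → ℝ) where
  toFun F φ ζ := F (φ + ζ)
  map_one' := rfl
  map_mul' _ _ := rfl
  map_zero' := rfl
  map_add' _ _ := rfl

/-- `θF(φ,ζ) = F(φ+ζ)`. [folklore] -/
@[simp] theorem thetaHom_apply (F : Φ → ℝ) (φ ζ : Φ) : thetaHom Φ F φ ζ = F (φ + ζ) := rfl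

/-- **The inclusion `ι`** of fluctuation-free elements: `ιF(φ, ζ) = F(φ)` (elements "with no
fluctuation fields upon which `𝔼₊` can act"). [cite: BrydgesSlade2015RGV, §5.1 (proof of Proposition (prop:K3))] -/
def iotaHom (Φ : Type*) [AddCommGroup Φ] : (Φ → ℝ) →+* (Φ → Φ → ℝ) where
  toFun F φ _ := F φ
  map_one' := rfl
  map_mul' _ _ := rfl
  map_zero' := rfl
  map_add' _ _ := rfl

/-- `ιF(φ,ζ) = F(φ)`. [folklore] -/
@[simp] theorem iotaHom_apply (F : Φ → ℝ) (φ ζ : Φ) : iotaHom Φ F φ ζ = F φ := rfl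

variable [MeasurableSpace Φ]

/-- **The fluctuation expectation** `(E G)(φ) = ∫ G(φ, ζ) dP(ζ)` ("In applying `𝔼_{j+1}θ`, the
fields `ξ, …` are integrated out by `𝔼_{j+1}`, with `φ, …` kept fixed"; Bochner integral, `0` on
non-integrable sections). [cite: BrydgesSlade2015RGV, §1.3] [cite: Slade2017, §4.1 ("the expectation E_C acts on ζ and leaves φ fixed")] -/
def expectOp (P : Measure Φ) (G : Φ → Φ → ℝ) (φ : Φ) : ℝ := ∫ ζ, G φ ζ ∂P

/-- `E ∘ θ = E_P θ` (`thetaConv`). [cite: Slade2017, §4.1 (definition of E_Cθ)] -/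
theorem expectOp_thetaHom (P : Measure Φ) (F : Φ → ℝ) : expectOp P (thetaHom Φ F) = thetaConv P F := rfl

omit [AddCommGroup Φ] in
/-- `E 1 = 1` for a probability measure. [folklore] -/
theorem expectOp_one (P : Measure Φ) [IsProbabilityMeasure P] : expectOp P 1 = 1 := by
  funext φ
  simp [expectOp]

/-- `E(ι a) = a` for a probability measure. [folklore] -/
theorem expectOp_iotaHom (P : Measure Φ) [IsProbabilityMeasure P] (a : Φ → ℝ) : expectOp P (iotaHom Φ a) = a := by
  funext φ
  simp [expectOp]

/-- Admissibility for `E`: every section `ζ ↦ G(φ, ζ)` is integrable. [folklore] -/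
def SecIntegrable (P : Measure Φ) (G : Φ → Φ → ℝ) : Prop := ∀ φ, Integrable (G φ) P

/-- **`E` is `𝒩`-linear on finite combinations of admissible elements**:
`E(Σ_i ι(a_i) n_i) = Σ_i a_i E(n_i)` ("There is no `θ` operating on `Ĩ_pt`, and this factor contains
no fluctuation fields upon which `𝔼₊` can act"). [cite: BrydgesSlade2015RGV, §5.1 (proof of Proposition (prop:K3))] -/
theorem expectOp_sum_iotaHom_mul {β : Type*} (P : Measure Φ) (s : Finset β) (a : β → Φ → ℝ) (n : β → Φ → Φ → ℝ)
    (hn : ∀ i ∈ s, SecIntegrable P (n i)) :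
    expectOp P (∑ i ∈ s, iotaHom Φ (a i) * n i) = ∑ i ∈ s, a i * expectOp P (n i) := by
  funext φ
  simp only [expectOp, Finset.sum_apply, Pi.mul_apply, iotaHom_apply]
  rw [integral_finsetSum _ fun i hi => (hn i hi φ).const_mul (a i φ)]
  refine Finset.sum_congr rfl fun i _ => ?_
  exact integral_const_mul (a i φ) (n i φ)

/-- **Dependence on the fluctuation field only inside `D`** (and joint measurability in
`(φ, ζ)`): the concrete form of "`G ∈ 𝒩(Λ ⊔ D')`" for the `ζ`-variable. [cite: BrydgesSlade2015RGI, §2.11 (𝒩(Λ ⊔ X'))] -/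
def FlucDep {Λ V : Type*} [MeasurableSpace (Λ → V)] (D : Finset Λ) (G : (Λ → V) → (Λ → V) → ℝ) : Prop :=
  (∀ φ ζ ζ' : Λ → V, (∀ x ∈ D, ζ x = ζ' x) → G φ ζ = G φ ζ') ∧ Measurable (Function.uncurry G)

section FlucDepAlgebra

variable {Λ V : Type*} [MeasurableSpace V] {D D' : Finset Λ} {G G' : (Λ → V) → (Λ → V) → ℝ}

omit [MeasurableSpace Φ] in
/-- Sections of a `FlucDep` element are measurable. [folklore] -/
theorem FlucDep.measurable_apply (h : FlucDep D G) (φ : Λ → V) : Measurable (G φ) :=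
  h.2.comp measurable_prodMk_left

omit [MeasurableSpace Φ] in
/-- Monotonicity of `FlucDep` in the region. [folklore] -/
theorem FlucDep.mono (h : FlucDep D G) (hDD' : D ⊆ D') : FlucDep D' G :=
  ⟨fun φ ζ ζ' hζ => h.1 φ ζ ζ' fun x hx => hζ x (hDD' hx), h.2⟩

omit [MeasurableSpace Φ] in
/-- `FlucDep` is closed under products. [folklore] -/
theorem FlucDep.mul (h : FlucDep D G) (h' : FlucDep D G') : FlucDep D (G * G') :=
  ⟨fun φ ζ ζ' hζ => by simp only [Pi.mul_apply, h.1 φ ζ ζ' hζ, h'.1 φ ζ ζ' hζ], h.2.mul h'.2⟩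

omit [MeasurableSpace Φ] in
/-- `FlucDep` is closed under differences. [folklore] -/
theorem FlucDep.sub (h : FlucDep D G) (h' : FlucDep D G') : FlucDep D (G - G') :=
  ⟨fun φ ζ ζ' hζ => by simp only [Pi.sub_apply, h.1 φ ζ ζ' hζ, h'.1 φ ζ ζ' hζ], h.2.sub h'.2⟩

omit [MeasurableSpace Φ] in
/-- `FlucDep` is closed under finite products. [folklore] -/
theorem FlucDep.prod {β : Type*} {s : Finset β} {f : β → (Λ → V) → (Λ → V) → ℝ} (h : ∀ i ∈ s, FlucDep D (f i)) :
    FlucDep D (∏ i ∈ s, f i) := by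
  refine ⟨fun φ ζ ζ' hζ => ?_, ?_⟩
  · simp only [Finset.prod_apply]
    exact Finset.prod_congr rfl fun i hi => (h i hi).1 φ ζ ζ' hζ
  · have : Function.uncurry (∏ i ∈ s, f i) = fun p => ∏ i ∈ s, Function.uncurry (f i) p := by
      funext p; simp only [Function.uncurry, Finset.prod_apply]
    rw [this]
    exact Finset.measurable_prod _ fun i hi => (h i hi).2

omit [MeasurableSpace Φ] in
/-- `FlucDep` is closed under finite sums. [folklore] -/
theorem FlucDep.sum {β : Type*} {s : Finset β} {f : β → (Λ → V) → (Λ → V) → ℝ} (h : ∀ i ∈ s, FlucDep D (f i)) :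
    FlucDep D (∑ i ∈ s, f i) := by
  refine ⟨fun φ ζ ζ' hζ => ?_, ?_⟩
  · simp only [Finset.sum_apply]
    exact Finset.sum_congr rfl fun i hi => (h i hi).1 φ ζ ζ' hζ
  · have : Function.uncurry (∑ i ∈ s, f i) = fun p => ∑ i ∈ s, Function.uncurry (f i) p := by
      funext p; simp only [Function.uncurry, Finset.sum_apply]
    rw [this]
    exact Finset.measurable_sum _ fun i hi => (h i hi).2

end FlucDepAlgebra

variable {Λ : Type*} {n : ℕ}

/-- Fluctuation-free (measurable) elements depend on `ζ` nowhere. [folklore] -/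
theorem flucDep_iotaHom (D : Finset Λ) {a : (Λ → Fin n → ℝ) → ℝ} (ma : Measurable a) :
    FlucDep D (iotaHom (Λ → Fin n → ℝ) a) :=
  ⟨fun _ _ _ _ => rfl, ma.comp measurable_fst⟩

/-- **`θ` transports field locality**: if `F ∈ 𝒩(D)` is measurable then `θF` depends on `ζ` only
in `D` (and is jointly measurable). [cite: BrydgesSlade2015RGV, §1.3 (θ : 𝒩(Λ) → 𝒩(Λ ⊔ Λ'))] -/
theorem flucDep_thetaHom [Fintype Λ] {D : Finset Λ} {F : (Λ → Fin n → ℝ) → ℝ}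
    (hF : ∀ φ ψ : Λ → Fin n → ℝ, (∀ x ∈ D, φ x = ψ x) → F φ = F ψ) (mF : Measurable F) :
    FlucDep D (thetaHom (Λ → Fin n → ℝ) F) := by
  refine ⟨fun φ ζ ζ' hζ => hF _ _ fun x hx => ?_, mF.comp (measurable_fst.add measurable_snd)⟩
  simp only [Pi.add_apply, hζ x hx]

/-- **`E` preserves measurability**: `φ ↦ ∫ G(φ,ζ) dP(ζ)` is measurable for jointly measurable `G`. [folklore] -/
theorem measurable_expectOp [Fintype Λ] {P : Measure (Λ → Fin n → ℝ)} [SFinite P] {D : Finset Λ}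
    {G : (Λ → Fin n → ℝ) → (Λ → Fin n → ℝ) → ℝ} (h : FlucDep D G) : Measurable (expectOp P G) := by
  have hs : StronglyMeasurable (Function.uncurry G) := h.2.stronglyMeasurable
  exact (hs.integral_prod_right (ν := P)).measurable

end FluctuationAlgebra


section ExpectFactorisation

variable {Λ : Type*} [Fintype Λ] [DecidableEq Λ] {n : ℕ}

/-- **The factorisation hypothesis `hEfac` of the abstract Map 3, discharged for the Gaussian
fluctuation expectation**: if `G₁` depends on `ζ` only in `D₁`, `G₂` only in `D₂`, and
`C_{xy} = 0` for `x ∈ D₁`, `y ∈ D₂`, then `E(G₁G₂) = E(G₁)E(G₂)` for `E = ` integration of `ζ`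
against `P_C`. [cite: BrydgesSlade2015RGI, §2.11, Proposition (factorisation property), bosonic part] [cite: BrydgesSlade2015RGV, §1.3 (display (Efaczz))] -/
theorem expectOp_mul_of_flucDep {C : Matrix Λ Λ ℝ} (hC : C.PosSemidef) {D₁ D₂ : Finset Λ}
    (h0 : ∀ x ∈ D₁, ∀ y ∈ D₂, C x y = 0) {G₁ G₂ : (Λ → Fin n → ℝ) → (Λ → Fin n → ℝ) → ℝ}
    (h₁ : FlucDep D₁ G₁) (h₂ : FlucDep D₂ G₂) :
    expectOp (fieldGaussian Λ C n) (G₁ * G₂) =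
      expectOp (fieldGaussian Λ C n) G₁ * expectOp (fieldGaussian Λ C n) G₂ := by
  funext φ
  simp only [expectOp, Pi.mul_apply]
  exact integral_mul_eq_mul_integral_of_dependsOn hC h0 (fun ζ ζ' h => h₁.1 φ ζ ζ' h)
    (fun ζ ζ' h => h₂.1 φ ζ ζ' h) (h₁.measurable_apply φ) (h₂.measurable_apply φ)

end ExpectFactorisation

end LongRangePhi4

end Literature.Barriers.CriticalPhenomena
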